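import Mathlib.NumberTheory.LSeries.RiemannZeta
import Mathlib.MeasureTheory.Integral.Bochner.Basic
import Mathlib.Analysis.SpecialFunctions.Trigonometric.Basic
import Literature.NumberTheory.LFunctions.RiemannXi
import HarnessLib

-- provenance: harness21/H21/H21/Prelude/AntSieve/DeBruijnNewman.lean @ ec52c55 (interim HEAD d8f2665); M5 mechanical rewrite
/-!
# The de Bruijn–Newman constant

Trunk: AntSieve (analytic number theory / sieves), concept C6 of `H21/Outlines/AntSieve.md`;
notion `de_bruijn_newman_constant`.

## Contents

We follow the normalisation of Rodgers–Tao (2020), §1: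

* `Literature.deBruijnPhi u = ∑_{n ≥ 1} (2π² n⁴ e^{9u} − 3π n² e^{5u}) exp(−π n² e^{4u})`, the
  super-exponentially decaying, positive, even Pólya kernel `Φ`;
* `Literature.deBruijnH t z = ∫_0^∞ e^{t u²} Φ(u) cos(z u) du`, de Bruijn's family `H_t` of even entire
  functions, with `H_0(z) = ξ(1/2 + i z/2) / 8` (`Literature.NumberTheory.LFunctions.deBruijnH_zero_eq`);
* `Literature.HasOnlyRealZeros H`: every zero of `H : ℂ → ℂ` is real;
* `Literature.deBruijnNewmanConst = Λ = inf {t | H_t has only real zeros}`.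

The Riemann hypothesis is equivalent to `HasOnlyRealZeros (deBruijnH 0)`, i.e. to `Λ ≤ 0`
(`Literature.NumberTheory.LFunctions.riemannHypothesis_iff_hasOnlyRealZeros_deBruijnH_zero`); Newman conjectured and
Rodgers–Tao proved `Λ ≥ 0`.

## Design

`deBruijnNewmanConst` is a bare `sInf` over `ℝ`; it is meaningful only because the set is nonempty
(`hasOnlyRealZeros_deBruijnH_one_half`, de Bruijn 1950) and bounded below
(`bddBelow_setOf_hasOnlyRealZeros`, Newman 1976), both recorded here with `sorry` proofs. All
target statements downstream (rh.S28) are therefore phrased `sInf`-free, as `∀ t`-statements about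
`HasOnlyRealZeros (deBruijnH t)`, and the `sInf` forms are derived via
`Literature.NumberTheory.LFunctions.deBruijnNewmanConst_le_iff`.

Mathlib has `riemannZeta`, `RiemannHypothesis`, `tsum`, the Bochner integral on `Set.Ioi 0` and
`Complex.cos`, but nothing on `Φ`, `H_t` or `Λ` (searched `deBruijn`, `Newman`).

## References

* N. G. de Bruijn, *The roots of trigonometric integrals*, Duke Math. J. 17 (1950), Thm. 13.
* C. M. Newman, *Fourier transforms with only real zeros*, Proc. AMS 61 (1976), Thm. 3.
* G. Pólya, *Über trigonometrische Integrale mit nur reellen Nullstellen*, Crelle 158 (1927).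
* B. Rodgers, T. Tao, *The de Bruijn–Newman constant is non-negative*, Forum Math. Pi 8 (2020),
  §1 (normalisation, eq. (1)–(3)).
* E. C. Titchmarsh, *The theory of the Riemann zeta-function*, 2nd ed., §10.1.
-/

noncomputable section

open Complex MeasureTheory Real

namespace Literature.NumberTheory.LFunctions

/-! ## The kernel `Φ` -/

/-- The `n`-th summand of the Pólya–de Bruijn kernel, indexed from `n = 0` so that it is the
term of index `n + 1` in Rodgers–Tao (2020) eq. (2):
`(2π² (n+1)⁴ e^{9u} − 3π (n+1)² e^{5u}) exp(−π (n+1)² e^{4u})`. [cite: RodgersTao2020] -/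
def deBruijnPhiSummand (n : ℕ) (u : ℝ) : ℝ :=
  (2 * π ^ 2 * ((n : ℝ) + 1) ^ 4 * Real.exp (9 * u) - 3 * π * ((n : ℝ) + 1) ^ 2 * Real.exp (5 * u)) *
    Real.exp (-(π * ((n : ℝ) + 1) ^ 2 * Real.exp (4 * u)))

/-- The Pólya–de Bruijn kernel
`Φ(u) = ∑_{n ≥ 1} (2π² n⁴ e^{9u} − 3π n² e^{5u}) exp(−π n² e^{4u})`
(Rodgers–Tao 2020, eq. (2); Titchmarsh §10.1). [cite: RodgersTao2020, eq. (2] -/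
def deBruijnPhi (u : ℝ) : ℝ :=
  ∑' n : ℕ, deBruijnPhiSummand n u

/-- The series defining `Φ(u)` converges (absolutely) for every real `u`, by the
super-exponential factor `exp(−π n² e^{4u})` (Titchmarsh §10.1). [cite: Titchmarsh1986, §10.1] -/
def summable_deBruijnPhi : Prop :=
  ∀ (u : ℝ),
    Summable fun n : ℕ ↦ deBruijnPhiSummand n u

/-- `Φ(u) > 0` for all real `u` (Pólya 1927; see Csordas–Norfolk–Varga, *The Riemann hypothesis
and the Turán inequalities*, Trans. AMS 296 (1986), Thm. A (ii)). [cite: Polya1927] -/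
def deBruijnPhi_pos : Prop :=
  ∀ (u : ℝ),
    0 < deBruijnPhi u

/-- `Φ` is even: `Φ(−u) = Φ(u)`; this is equivalent to the functional equation of Jacobi's theta
function (Pólya 1927; Titchmarsh §10.1; Csordas–Norfolk–Varga 1986, Thm. A (iii)). [cite: Polya1927] -/
def deBruijnPhi_neg : Prop :=
  ∀ (u : ℝ),
    deBruijnPhi (-u) = deBruijnPhi u

/-- Super-exponential decay of `Φ`: there is `C` with `Φ(u) ≤ C exp(9u − π e^{4u})` for `u ≥ 0`
(Rodgers–Tao 2020, §1; Csordas–Norfolk–Varga 1986, Thm. A (iv)). [cite: RodgersTao2020, §1] -/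
def deBruijnPhi_le_exp : Prop :=
  ∃ C : ℝ, ∀ u : ℝ, 0 ≤ u → deBruijnPhi u ≤ C * Real.exp (9 * u - π * Real.exp (4 * u))

/-! ## de Bruijn's family `H_t` -/

/-- de Bruijn's family `H_t(z) = ∫_0^∞ e^{t u²} Φ(u) cos(z u) du` for real `t` and complex `z`
(de Bruijn 1950; Rodgers–Tao 2020, eq. (1)). The integral converges absolutely for every `t`
by `deBruijnPhi_le_exp`. [cite: Bruijn1950] -/
def deBruijnH (t : ℝ) (z : ℂ) : ℂ :=
  ∫ u in Set.Ioi (0 : ℝ), (Real.exp (t * u ^ 2) * deBruijnPhi u : ℂ) * Complex.cos (z * u)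

/-- `H_t` is an entire function of `z` for every real `t` (de Bruijn 1950; Rodgers–Tao 2020,
§1). [cite: Bruijn1950] -/
def differentiable_deBruijnH : Prop :=
  ∀ (t : ℝ),
    Differentiable ℂ (deBruijnH t)

/-- `H_t` is even in `z`: `H_t(−z) = H_t(z)`, since `cos` is even. [folklore] -/
theorem deBruijnH_neg (t : ℝ) (z : ℂ) : deBruijnH t (-z) = deBruijnH t z := by
  simp [deBruijnH, neg_mul, Complex.cos_neg]

/-- At `t = 0`, `H_0(z) = ξ(1/2 + i z / 2) / 8 = Ξ(z/2) / 8` (Titchmarsh §10.1, eq. (10.1.2)–(10.1.4);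
Rodgers–Tao 2020, eq. (3)). [cite: RodgersTao2020, eq. (3] -/
def deBruijnH_zero_eq : Prop :=
  ∀ (z : ℂ),
    deBruijnH 0 z = riemannXi (1 / 2 + I * z / 2) / 8

/-! ## Real zeros and the constant `Λ` -/

/-- `HasOnlyRealZeros H`: every zero of `H : ℂ → ℂ` is real. [folklore] -/
def HasOnlyRealZeros (H : ℂ → ℂ) : Prop :=
  ∀ z : ℂ, H z = 0 → z.im = 0

/-- The de Bruijn–Newman constant `Λ = inf {t : ℝ | H_t has only real zeros}` (Newman 1976;
Rodgers–Tao 2020, §1). *Warning:* as a bare `sInf` in `ℝ` this is meaningful only via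
`hasOnlyRealZeros_deBruijnH_one_half` (the set is nonempty, de Bruijn 1950) and
`bddBelow_setOf_hasOnlyRealZeros` (it is bounded below, Newman 1976); target statements are
phrased `sInf`-free and converted with `deBruijnNewmanConst_le_iff`. Known: `0 ≤ Λ ≤ 0.2`
(Rodgers–Tao 2020; Platt–Trudgian 2021), and RH `↔ Λ ≤ 0 ↔ Λ = 0`. [cite: Newman1976] -/
def deBruijnNewmanConst : ℝ :=
  sInf {t : ℝ | HasOnlyRealZeros (deBruijnH t)}

/-- de Bruijn's monotonicity theorem: if `H_t` has only real zeros then so does `H_{t'}` for every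
`t' ≥ t` (de Bruijn 1950, Thm. 13). [cite: Bruijn1950, Thm. 13] -/
def HasOnlyRealZeros.mono_deBruijnH : Prop :=
  ∀ {t t' : ℝ} (h : t ≤ t') (ht : HasOnlyRealZeros (deBruijnH t)),
    HasOnlyRealZeros (deBruijnH t')

/-- `H_{1/2}` has only real zeros, so `{t | H_t has only real zeros}` is nonempty and `Λ ≤ 1/2`
(de Bruijn 1950, Thm. 13 applied to `Φ`). [cite: Bruijn1950, Thm. 13 applied to  Φ] -/
def hasOnlyRealZeros_deBruijnH_one_half : Prop :=
  HasOnlyRealZeros (deBruijnH (1 / 2))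

/-- Newman's theorem: `{t | H_t has only real zeros}` is bounded below, i.e. `Λ > −∞`
(Newman 1976, Thm. 3). [cite: Newman1976, Thm. 3] -/
def bddBelow_setOf_hasOnlyRealZeros : Prop :=
  BddBelow {t : ℝ | HasOnlyRealZeros (deBruijnH t)}

/-- The Riemann hypothesis is equivalent to `H_0` having only real zeros, since
`H_0(z) = Ξ(z/2)/8` (Titchmarsh §10.1; Rodgers–Tao 2020, §1). [cite: RodgersTao2020, §1] -/
def riemannHypothesis_iff_hasOnlyRealZeros_deBruijnH_zero : Prop :=
  RiemannHypothesis ↔ HasOnlyRealZeros (deBruijnH 0)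

/- interim proof relied on results that are now named facts (D-0014); demoted to a fact by the M5 import, proof preserved:
:= by
  rw [riemannHypothesis_iff_im_eq_zero_of_riemannXiUpper_eq_zero]
  have key : ∀ z : ℂ, deBruijnH 0 z = riemannXiUpper (z / 2) / 8 := fun z ↦ by
    rw [deBruijnH_zero_eq, riemannXiUpper]
    congr 3
    ring
  constructor
  · intro h z hz
    rw [key, div_eq_zero_iff] at hz
    have := h (z / 2) (hz.resolve_right (by norm_num))
    simpa using this
  · intro h z hz
    have := h (2 * z) (by rw [key]; simp [hz])
    simpa using this
-/

/-- Characterisation of `Λ ≤ t` without `sInf`: `Λ ≤ t` iff `H_{t'}` has only real zeros for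
every `t' > t`. Uses nonemptiness (`hasOnlyRealZeros_deBruijnH_one_half`), Newman's lower
bound (`bddBelow_setOf_hasOnlyRealZeros`) and de Bruijn's monotonicity
(`HasOnlyRealZeros.mono_deBruijnH`). [folklore] -/
def deBruijnNewmanConst_le_iff : Prop :=
  ∀ (t : ℝ),
    deBruijnNewmanConst ≤ t ↔ ∀ t' : ℝ, t < t' → HasOnlyRealZeros (deBruijnH t')

/- interim proof relied on results that are now named facts (D-0014); demoted to a fact by the M5 import, proof preserved:
:= by
  have hne : {t : ℝ | HasOnlyRealZeros (deBruijnH t)}.Nonempty :=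
    ⟨1 / 2, hasOnlyRealZeros_deBruijnH_one_half⟩
  constructor
  · intro h t' ht'
    obtain ⟨s, hs, hst⟩ := (csInf_lt_iff bddBelow_setOf_hasOnlyRealZeros hne).1
      (lt_of_le_of_lt h ht')
    exact HasOnlyRealZeros.mono_deBruijnH hst.le hs
  · intro h
    refine le_of_forall_gt_imp_ge_of_dense fun t' ht' ↦ ?_
    exact csInf_le bddBelow_setOf_hasOnlyRealZeros (h t' ht')
-/

end Literature.NumberTheory.LFunctions
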